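/-
Copyright (c) 2026 the pub-hodgecm-mathlib formalisation cell (harness21).  Prover seat hodgecm-mathlib-LD1-p02 (g4), FLOOR 0, programme P6,
half-A line LD1 of crux `hLiu418`, brick (Gα-C∞) `ArchLadder`, plate (P4) «ι-step» (dealer LD1-plan (g2) DEALS #10 ∕ #10-bis 2026-09-02T10:20:38Z),
sub-bricks (P4a) + (P4d).  KERNEL module: THEOREMS ONLY (no definition, no named fact, no `sorry`, no instance, no notation).
-/
import Literature.NumberTheory.Weil1964.ArchMetaplecticUnitarySplittingContinuity
import Literature.RepresentationTheory.KonnoKonno2007.JunctionSqueezedVacuum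
import Literature.RepresentationTheory.KonnoKonno2007.JunctionHyperbolicDerivative
import HarnessLib

/-!
# The `det^{1/2}`-normalised Weil operator of a boost IS a unimodular multiple of `hypOp t`, and the Hermite matrix coefficients of
# `hypOp t h_β` leave the diagonal with non-zero speed exactly along the ladder `β ↦ β ± (e_{p₀} + e_{q₀})`

Topic `RepresentationTheory/KonnoKonno2007`; namespace `Literature.RepresentationTheory.KonnoKonno2007.RealDualPair`.  KERNEL ONLY: proved
theorems about tree definitions; 0 definitions, 0 records, 0 `sorry`.

Setting: the real unitary dual pair `U(P,Q) × U(R,S)` in its Fock–Schrödinger model on `𝓢(ℝ^{DPIdx P Q R S})` (★ `RealUnitaryDualPairSL2`,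
★ `JunctionHyperbolicFamily`): the boost `a_t = hypV p₀ q₀ t ∈ U(P,Q)` of the hyperbolic plane `{e_{p₀}, e_{q₀}}`, its explicit implementer family
`hypOp R S p₀ q₀ t = μ₀(u)⁻¹ ∘ leviS(δ_{eᵗ}) ∘ μ₀(u)` and the `det^{1/2}`-normalised splitting `weilHomV P Q R S : U(P,Q) →* Mp^𝓢` (★
`ArchMetaplecticUnitarySplitting`).

* §1 **`weilHomV_hypV_eq_smul_hypOp`** — Schur with coefficients ([Folland1989, §4.2 p. 156]): the operator of `weilHomV (hypV p₀ q₀ t)` is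
  `c(t) • hypOp t` with the EXPLICIT unimodular scalar `c(t) = C(weilHomV (hypV t)) ∕ C(hypOp t)` (`C` = vacuum coefficient; both implement the phase
  map of `ι𝕎 (a_t, 1)`: ★ `isImplementerS_weilHomV`, ★ `isImplementerS_hypOp`; `C(hypOp t) ≠ 0`: ★ `vacCoeffS_hypOp_ne_zero`).
* §2 (rank-one definite `W`: `[Unique R] [IsEmpty S]`) **`hasDerivAt_piCoeff_hypOp_hermitePi`** — the Hermite coefficient
  `t ↦ c_γ(hypOp t h_β) = ⟪h_γ, hypOp t h_β⟫` is differentiable at `t = 0` with derivative `−i (c⁺_γ [γ + d = β] + c⁻_γ [γ − d = β])`,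
  `d = e_{p₀} + e_{q₀}` (★ `hasDerivAt_apply_hypOp` + the closed system ★ `piCoeffCLM_hypOpGen` + orthonormality ★ `piCoeff_hermitePi`); in particular
  along the ladder: **`hasDerivAt_piCoeff_add_sqStep_hypOp_hermitePi`** (derivative `−i √((β_{p₀}+1)(β_{q₀}+1)) ≠ 0` at `γ = β + d`) and
  **`hasDerivAt_piCoeff_sub_sqStep_hypOp_hermitePi`** (derivative `−i √(β_{p₀} β_{q₀}) ≠ 0` at `γ = β − d`, `β_{p₀}, β_{q₀} ≥ 1`), whence
  **`exists_piCoeff_add_sqStep_hypOp_hermitePi_ne_zero`** ∕ **`exists_piCoeff_sub_sqStep_hypOp_hermitePi_ne_zero`**: SOME boost moves `h_β` onto its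
  two ladder neighbours with a non-zero coefficient ([Folland1989, §1.7 (1.82), §4.4 Thm. (4.37)]: the `U(1,1)`-ladder of the oscillator representation).

These are the archimedean inputs, at the one indefinite place, of the «ι-step» of the archimedean generation brick (Gα-C∞) `ArchLadder` of line LD1
(crux `hLiu418`, cell hodgecm-mathlib); nothing of [Liu2021] is asserted and HC_CM is NOT proved here or anywhere in the tree.

## References
* [Folland1989] G. B. Folland, *Harmonic Analysis in Phase Space*, Princeton UP 1989, §1.7 (1.82), §4.2 (4.24) and the Schur remark p. 156,
  Prop. (4.39), §4.4 Thm. (4.37).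
* [KonnoKonno2007] K. Konno, T. Konno, Kyushu J. Math. 61 (2007), §3.1 (3.1), §3.3 (conventions of the junction only).
* [KashiwaraVergne1978] M. Kashiwara, M. Vergne, Invent. Math. 44 (1978), §6 (the `U(1,1)`-ladder inside one `U(1)`-isotypic component).
-/

set_option autoImplicit false

noncomputable section

open Matrix Complex MeasureTheory Filter SchwartzMap
open scoped Topology Real InnerProductSpace ComplexConjugate

namespace Literature.RepresentationTheory.KonnoKonno2007

namespace RealDualPair

open Literature.Analysis.SegalBargmann Literature.RepresentationTheory.HeisenbergGroup
open Literature.NumberTheory.Weil1964 Literature.NumberTheory.Weil1964.MpS Literature.NumberTheory.Weil1964.UnitaryWeil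
open Literature.NumberTheory.Automorphic Literature.NumberTheory.Automorphic.UnitaryGroup

/-! ## §1 The Weil operator of a boost is a unimodular multiple of `hypOp t` -/

section Schur

variable {P Q : Type*} (R S : Type*) [Fintype P] [DecidableEq P] [Fintype Q] [DecidableEq Q] [Fintype R] [DecidableEq R]
  [Fintype S] [DecidableEq S] (p₀ : P) (q₀ : Q)

/-- **Schur with coefficients for the boost**: there is a unimodular `c` with `weilHomV (a_t) = c • hypOp t` as operators of `𝓢(ℝ^{DPIdx})`
(both implement `ι𝕎 (a_t, 1)`). [cite: Folland1989, §4.2, the Schur remark p. 156] -/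
theorem exists_weilHomV_hypV_eq_smul_hypOp (t : ℝ) :
    ∃ c : ℂ, ‖c‖ = 1 ∧
      (((weilHomV P Q R S (hypV p₀ q₀ t)).1.2 : (SchwartzMap (DPIdx P Q R S → ℝ) ℂ) ≃L[ℂ] SchwartzMap (DPIdx P Q R S → ℝ) ℂ) :
          (SchwartzMap (DPIdx P Q R S → ℝ) ℂ) →L[ℂ] SchwartzMap (DPIdx P Q R S → ℝ) ℂ) = c • hypOp R S p₀ q₀ t :=
  (isImplementerS_hypOp R S p₀ q₀ t).exists_eq_smul (isImplementerS_weilHomV (R := R) (S := S) (hypV p₀ q₀ t))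

/-- **THE WEIL OPERATOR OF A BOOST**: `weilHomV (a_t) = (C(weilHomV a_t) ∕ C(hypOp t)) • hypOp t` — the scalar read off at the vacuum
(`C(hypOp t) ≠ 0`, ★ `vacCoeffS_hypOp_ne_zero`). [cite: Folland1989, §4.2 (4.24), the Schur remark p. 156] -/
theorem weilHomV_hypV_eq_smul_hypOp (t : ℝ) :
    (((weilHomV P Q R S (hypV p₀ q₀ t)).1.2 : (SchwartzMap (DPIdx P Q R S → ℝ) ℂ) ≃L[ℂ] SchwartzMap (DPIdx P Q R S → ℝ) ℂ) :
          (SchwartzMap (DPIdx P Q R S → ℝ) ℂ) →L[ℂ] SchwartzMap (DPIdx P Q R S → ℝ) ℂ) =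
      (vac (weilHomV P Q R S (hypV p₀ q₀ t)) / vacCoeffS (hypOp R S p₀ q₀ t)) • hypOp R S p₀ q₀ t := by
  obtain ⟨c, -, hc⟩ := exists_weilHomV_hypV_eq_smul_hypOp R S p₀ q₀ t
  have hv : vac (weilHomV P Q R S (hypV p₀ q₀ t)) = c * vacCoeffS (hypOp R S p₀ q₀ t) := by
    rw [MpS.vac, hc, vacCoeffS_smul]
  rw [hv, mul_div_assoc, div_self (vacCoeffS_hypOp_ne_zero R S p₀ q₀ t), mul_one]
  exact hc

/-- pointwise form of `weilHomV_hypV_eq_smul_hypOp`. [cite: Folland1989, §4.2 (4.24), p. 156] -/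
theorem weilHomV_hypV_apply (t : ℝ) (f : SchwartzMap (DPIdx P Q R S → ℝ) ℂ) :
    (weilHomV P Q R S (hypV p₀ q₀ t)).1.2 f =
      (vac (weilHomV P Q R S (hypV p₀ q₀ t)) / vacCoeffS (hypOp R S p₀ q₀ t)) • hypOp R S p₀ q₀ t f := by
  have h := ContinuousLinearMap.ext_iff.1 (weilHomV_hypV_eq_smul_hypOp R S p₀ q₀ t) f
  exact h

/-- the Schur scalar `C(weilHomV a_t) ∕ C(hypOp t)` is unimodular. [cite: Folland1989, §4.2 p. 156] -/
theorem norm_vac_weilHomV_hypV_div_vacCoeffS_hypOp (t : ℝ) :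
    ‖vac (weilHomV P Q R S (hypV p₀ q₀ t)) / vacCoeffS (hypOp R S p₀ q₀ t)‖ = 1 := by
  obtain ⟨c, hc1, hc⟩ := exists_weilHomV_hypV_eq_smul_hypOp R S p₀ q₀ t
  have hv : vac (weilHomV P Q R S (hypV p₀ q₀ t)) = c * vacCoeffS (hypOp R S p₀ q₀ t) := by
    rw [MpS.vac, hc, vacCoeffS_smul]
  rw [hv, mul_div_assoc, div_self (vacCoeffS_hypOp_ne_zero R S p₀ q₀ t), mul_one, hc1]

/-- … and non-zero. [cite: Folland1989, §4.2 p. 156] -/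
theorem vac_weilHomV_hypV_div_vacCoeffS_hypOp_ne_zero (t : ℝ) :
    vac (weilHomV P Q R S (hypV p₀ q₀ t)) / vacCoeffS (hypOp R S p₀ q₀ t) ≠ 0 := fun h => by
  have h1 := norm_vac_weilHomV_hypV_div_vacCoeffS_hypOp R S p₀ q₀ t
  rw [h, norm_zero] at h1
  exact zero_ne_one h1

end Schur

/-! ## §2 The Hermite matrix coefficients of `hypOp t h_β` near `t = 0`: the ladder with non-zero speed -/

section Ladder

variable {P Q : Type*} (R S : Type*) [Fintype P] [DecidableEq P] [Fintype Q] [DecidableEq Q] [Fintype R] [DecidableEq R]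
  [Fintype S] [DecidableEq S] [Unique R] [IsEmpty S] (p₀ : P) (q₀ : Q)

/-- **THE COEFFICIENT ODE AT `t = 0` ON A HERMITE VECTOR**: `t ↦ c_γ(hypOp t h_β)` has derivative
`−i (c⁺_γ · [γ + d = β] + c⁻_γ · [γ − d = β])` at `0` (`d = e_{p₀} + e_{q₀}`; `c_γ = piCoeff γ = ⟪h_γ, ·⟫`).
[cite: Folland1989, §1.7 (1.82), §4.2 (4.24)] -/
theorem hasDerivAt_piCoeff_hypOp_hermitePi (γ β : DPIdx P Q R S →₀ ℕ) :
    HasDerivAt (fun t : ℝ => piCoeff γ (hypOp R S p₀ q₀ t (hermitePi β)))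
      (-(I * ((((cUp R S p₀ q₀ default γ : ℝ) : ℂ)) * (if γ + sqStep R S p₀ q₀ default = β then 1 else 0) +
        (((cDown R S p₀ q₀ default γ : ℝ) : ℂ)) * (if γ - sqStep R S p₀ q₀ default = β then 1 else 0)))) 0 := by
  have h := hasDerivAt_apply_hypOp R S p₀ q₀ ((piCoeffCLM γ).restrictScalars ℝ) (hermitePi β) 0
  simp only [ContinuousLinearMap.coe_restrictScalars', piCoeffCLM_apply] at h
  rw [hypOp_zero, ContinuousLinearMap.id_apply, ← piCoeffCLM_apply, piCoeffCLM_hypOpGen, piCoeffCLM_apply, piCoeffCLM_apply,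
    piCoeff_hermitePi, piCoeff_hermitePi] at h
  exact h

omit [Unique R] [IsEmpty S] in
/-- at `t = 0` the off-diagonal coefficients vanish: `c_γ(hypOp 0 h_β) = [γ = β]`. [cite: Folland1989, §1.7] -/
theorem piCoeff_hypOp_zero_hermitePi (γ β : DPIdx P Q R S →₀ ℕ) :
    piCoeff γ (hypOp R S p₀ q₀ 0 (hermitePi β)) = if γ = β then 1 else 0 := by
  rw [hypOp_zero, ContinuousLinearMap.id_apply, piCoeff_hermitePi]

omit [Fintype P] [DecidableEq P] [Fintype Q] [DecidableEq Q] [Fintype R] [DecidableEq R] [Fintype S] [DecidableEq S] [IsEmpty S] in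
/-- `(β + d) − d = β` and `β + d + d ≠ β`. [folklore] -/
private theorem add_sqStep_facts (β : DPIdx P Q R S →₀ ℕ) :
    β + sqStep R S p₀ q₀ default - sqStep R S p₀ q₀ default = β ∧ β + sqStep R S p₀ q₀ default + sqStep R S p₀ q₀ default ≠ β := by
  refine ⟨add_tsub_cancel_right β _, fun h => ?_⟩
  have h1 := congrArg (fun δ : DPIdx P Q R S →₀ ℕ => δ (idxP R S p₀ default)) h
  simp only [Finsupp.add_apply, sqStep_apply_idxP] at h1
  omega

/-- **UP THE LADDER**: `t ↦ c_{β+d}(hypOp t h_β)` has derivative `−i √((β_{p₀}+1)(β_{q₀}+1))` at `0`. [cite: Folland1989, §1.7 (1.82), §4.4 Thm. (4.37)] -/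
theorem hasDerivAt_piCoeff_add_sqStep_hypOp_hermitePi (β : DPIdx P Q R S →₀ ℕ) :
    HasDerivAt (fun t : ℝ => piCoeff (β + sqStep R S p₀ q₀ default) (hypOp R S p₀ q₀ t (hermitePi β)))
      (-(I * ((Real.sqrt ((β (idxP R S p₀ default) + 1) * (β (idxQ R S q₀ default) + 1)) : ℝ) : ℂ))) 0 := by
  have h := hasDerivAt_piCoeff_hypOp_hermitePi R S p₀ q₀ (β + sqStep R S p₀ q₀ default) β
  obtain ⟨h1, h2⟩ := add_sqStep_facts R S p₀ q₀ β
  rw [if_neg h2, h1, if_pos rfl, mul_zero, zero_add, mul_one, cDown, Finsupp.add_apply, Finsupp.add_apply, sqStep_apply_idxP,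
    sqStep_apply_idxQ] at h
  simpa only [Nat.cast_add, Nat.cast_one] using h

/-- **DOWN THE LADDER**: for `β_{p₀}, β_{q₀} ≥ 1`, `t ↦ c_{β−d}(hypOp t h_β)` has derivative `−i √(β_{p₀} β_{q₀})` at `0`.
[cite: Folland1989, §1.7 (1.82), §4.4 Thm. (4.37)] -/
theorem hasDerivAt_piCoeff_sub_sqStep_hypOp_hermitePi (β : DPIdx P Q R S →₀ ℕ) (hp : 1 ≤ β (idxP R S p₀ default))
    (hq : 1 ≤ β (idxQ R S q₀ default)) :
    HasDerivAt (fun t : ℝ => piCoeff (β - sqStep R S p₀ q₀ default) (hypOp R S p₀ q₀ t (hermitePi β)))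
      (-(I * ((Real.sqrt (β (idxP R S p₀ default) * β (idxQ R S q₀ default)) : ℝ) : ℂ))) 0 := by
  have hle : sqStep R S p₀ q₀ default ≤ β := by
    intro j
    classical
    rw [sqStep, Finsupp.add_apply, Finsupp.single_apply, Finsupp.single_apply]
    split_ifs with h1 h2 h2
    · exact absurd (h1.trans h2.symm) (idxP_ne_idxQ R S p₀ q₀ default)
    · subst h1; simpa using hp
    · subst h2; simpa using hq
    · simp
  have h1 : β - sqStep R S p₀ q₀ default + sqStep R S p₀ q₀ default = β := tsub_add_cancel_of_le hle
  have h2 : β - sqStep R S p₀ q₀ default - sqStep R S p₀ q₀ default ≠ β := fun h => by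
    have h3 := congrArg (fun δ : DPIdx P Q R S →₀ ℕ => δ (idxP R S p₀ default)) h
    simp only [Finsupp.tsub_apply, sqStep_apply_idxP] at h3
    omega
  have h := hasDerivAt_piCoeff_hypOp_hermitePi R S p₀ q₀ (β - sqStep R S p₀ q₀ default) β
  have hp' : ((β - sqStep R S p₀ q₀ default) (idxP R S p₀ default) : ℝ) + 1 = β (idxP R S p₀ default) := by
    rw [Finsupp.tsub_apply, sqStep_apply_idxP, Nat.cast_sub hp, Nat.cast_one, sub_add_cancel]
  have hq' : ((β - sqStep R S p₀ q₀ default) (idxQ R S q₀ default) : ℝ) + 1 = β (idxQ R S q₀ default) := by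
    rw [Finsupp.tsub_apply, sqStep_apply_idxQ, Nat.cast_sub hq, Nat.cast_one, sub_add_cancel]
  rw [h1, if_pos rfl, if_neg h2, mul_one, mul_zero, add_zero, cUp, hp', hq'] at h
  exact h

/-- a function vanishing identically has derivative `0`; so a non-zero derivative at `0` forces a non-zero value somewhere. [folklore] -/
private theorem exists_ne_zero_of_hasDerivAt {f : ℝ → ℂ} {c : ℂ} (hf : HasDerivAt f c 0) (hc : c ≠ 0) : ∃ t, f t ≠ 0 := by
  by_contra h
  simp only [not_exists, not_not] at h
  have hf0 : f = fun _ => 0 := funext h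
  rw [hf0] at hf
  exact hc (hf.unique (hasDerivAt_const 0 0))

/-- **SOME boost reaches the upper neighbour**: `∃ t, c_{β+d}(hypOp t h_β) ≠ 0`. [cite: Folland1989, §4.4 Thm. (4.37)] [cite: KashiwaraVergne1978, §6] -/
theorem exists_piCoeff_add_sqStep_hypOp_hermitePi_ne_zero (β : DPIdx P Q R S →₀ ℕ) :
    ∃ t : ℝ, piCoeff (β + sqStep R S p₀ q₀ default) (hypOp R S p₀ q₀ t (hermitePi β)) ≠ 0 := by
  refine exists_ne_zero_of_hasDerivAt (hasDerivAt_piCoeff_add_sqStep_hypOp_hermitePi R S p₀ q₀ β) ?_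
  refine neg_ne_zero.mpr (mul_ne_zero I_ne_zero (Complex.ofReal_ne_zero.mpr (Real.sqrt_ne_zero'.mpr ?_)))
  positivity

/-- **SOME boost reaches the lower neighbour** (`β_{p₀}, β_{q₀} ≥ 1`): `∃ t, c_{β−d}(hypOp t h_β) ≠ 0`.
[cite: Folland1989, §4.4 Thm. (4.37)] [cite: KashiwaraVergne1978, §6] -/
theorem exists_piCoeff_sub_sqStep_hypOp_hermitePi_ne_zero (β : DPIdx P Q R S →₀ ℕ) (hp : 1 ≤ β (idxP R S p₀ default))
    (hq : 1 ≤ β (idxQ R S q₀ default)) :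
    ∃ t : ℝ, piCoeff (β - sqStep R S p₀ q₀ default) (hypOp R S p₀ q₀ t (hermitePi β)) ≠ 0 := by
  refine exists_ne_zero_of_hasDerivAt (hasDerivAt_piCoeff_sub_sqStep_hypOp_hermitePi R S p₀ q₀ β hp hq) ?_
  refine neg_ne_zero.mpr (mul_ne_zero I_ne_zero (Complex.ofReal_ne_zero.mpr (Real.sqrt_ne_zero'.mpr ?_)))
  have hp1 : (0 : ℝ) < β (idxP R S p₀ default) := by exact_mod_cast hp
  have hq1 : (0 : ℝ) < β (idxQ R S q₀ default) := by exact_mod_cast hq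
  positivity

/-- **THE WEIL OPERATOR OF SOME BOOST reaches the upper neighbour**: `∃ t, c_{β+d}(weilHomV (a_t) h_β) ≠ 0` (§1 + the above).
[cite: Folland1989, §4.2 p. 156, §4.4 Thm. (4.37)] -/
theorem exists_piCoeff_add_sqStep_weilHomV_hypV_hermitePi_ne_zero (β : DPIdx P Q R S →₀ ℕ) :
    ∃ t : ℝ, piCoeff (β + sqStep R S p₀ q₀ default) ((weilHomV P Q R S (hypV p₀ q₀ t)).1.2 (hermitePi β)) ≠ 0 := by
  obtain ⟨t, ht⟩ := exists_piCoeff_add_sqStep_hypOp_hermitePi_ne_zero R S p₀ q₀ β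
  refine ⟨t, ?_⟩
  rw [weilHomV_hypV_apply, ← piCoeffCLM_apply, map_smul, smul_eq_mul, piCoeffCLM_apply]
  exact mul_ne_zero (vac_weilHomV_hypV_div_vacCoeffS_hypOp_ne_zero R S p₀ q₀ t) ht

/-- **THE WEIL OPERATOR OF SOME BOOST reaches the lower neighbour** (`β_{p₀}, β_{q₀} ≥ 1`). [cite: Folland1989, §4.2 p. 156, §4.4 Thm. (4.37)] -/
theorem exists_piCoeff_sub_sqStep_weilHomV_hypV_hermitePi_ne_zero (β : DPIdx P Q R S →₀ ℕ) (hp : 1 ≤ β (idxP R S p₀ default))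
    (hq : 1 ≤ β (idxQ R S q₀ default)) :
    ∃ t : ℝ, piCoeff (β - sqStep R S p₀ q₀ default) ((weilHomV P Q R S (hypV p₀ q₀ t)).1.2 (hermitePi β)) ≠ 0 := by
  obtain ⟨t, ht⟩ := exists_piCoeff_sub_sqStep_hypOp_hermitePi_ne_zero R S p₀ q₀ β hp hq
  refine ⟨t, ?_⟩
  rw [weilHomV_hypV_apply, ← piCoeffCLM_apply, map_smul, smul_eq_mul, piCoeffCLM_apply]
  exact mul_ne_zero (vac_weilHomV_hypV_div_vacCoeffS_hypOp_ne_zero R S p₀ q₀ t) ht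

end Ladder

end RealDualPair

end Literature.RepresentationTheory.KonnoKonno2007

end
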